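/-
COR-CM (cell pub-hodgecm2) — RSCONJ row Ω (A7, the ω-LABEL face of the μ ↦ μᶜ identification), ROUTE C
(`HOME/d2bridge/ident/ident-1/omega/OMEGA-ROUTE-C.md`): the θ-TWIST `g ↦ ḡ` of the unitary dual-pair Weil carriers is
TRANSPORT OF STRUCTURE along the anti-symplectic involution `Λ : (x, y) ↦ (x, −y)` of `𝕎_𝔸 = 𝔸ⁿ × 𝔸ⁿ`, which the tree
already implements as the relabelling `adelicMpContRelabel (C := −1)` (✔ `Weil1964/AdelicMetaplecticTransport`).
Seat prover-pub-hodgeaudit-ident-1-g3-0 (ident-1 GEN 3), checker ident-2, 2026-08-24.  PART IV (RecordSystemConjOmegaTwistAssembly):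
the two ASSEMBLY conveniences every consumer of Parts I–III needs.  KERNEL ONLY: one definition by `subst`/`refl` + theorems; no named
fact, no instance, no `sorry`.  HC_CM is NOT proved; HELD — WORLD = C FINAL; nothing displayed by an END is discharged here.
-/
import Summits.HodgeConjecture.CorCM.B01.Transposition.HComp.RecordSystemConjOmegaTwistCarriers
import HarnessLib

set_option autoImplicit false

/-!
# The θ-twist of the unitary dual-pair Weil carriers, IV: transport along an equality of splitting families; `𝔾`-equivariance

* §1 `omegaAtLineCongr (h : s = s′) : omegaAtLine hs a χ ≃ₗ[ℂ] omegaAtLine hs′ a χ` — Liu's carrier depends on the splitting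
  family `s` only (the compatibility proof `hs` enters Weil's finite factor through a proof), so an EQUALITY of families (the shape of
  the label theorem `conjFamily (sChiD μ) = sChiD μᶜ` of (C3′)) transports carriers and actions on the nose (`omegaAtLineCongr_rhoVAtLine`).
* §2 `omegaConjEquiv_rhoAtLine` — Part III's equivariance along `k ↦ k̄` read through two identifications `ι : G →* U(J_V)(𝔸_f)`,
  `ι′ : G′ →* U(J_V)(𝔸_f)` and any map `φ : G → G′` with `ι′ (φ g) = \overline{ι g}` (the shape of the model's `ιVE V.conj ∘ groupConj =
  (c ⊗ 1) ∘ ιVE V`): `Ω′ (rhoAtLine hs′ ι a χ g x) = rhoAtLine hs ι′ (−a) χ⁻¹ (φ g) (Ω′ x)`.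

References: [Liu2021] Def. 4.11 (l. 2092–2096), Def. 4.12, Rem. 4.4, App. C (l. 4624), App. D §D.1; [GelbartRogawski1991] §3.1 Remark p. 457.
-/

noncomputable section

open scoped Matrix Kronecker
open NumberField IsDedekindDomain
open Literature.RepresentationTheory.HeisenbergGroup
open Literature.NumberTheory.Automorphic Literature.NumberTheory.Automorphic.UnitaryGroup
open Literature.NumberTheory.Weil1964
open Literature.NumberTheory.GelbartRogawski1991 Literature.NumberTheory.GelbartRogawski1991.UnitaryDualPair
open Literature.NumberTheory.GelbartRogawski1991.UnitaryDualPair.WeilCoinv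
open Literature.RepresentationTheory
open Literature.NumberTheory.Automorphic.Liu2021.Def411WeilCarriers (TW JW JW_eq isSymm_TW isUnit_det_TW Chi lineChar
  lineChar_finAdelicCenter lineCenterEquiv lineCenterEquiv_apply IsAutomorphicOneChar omegaAtLine rhoVAtLine rhoAtLine rhoAtLine_apply)

namespace Summit.HodgeConjecture.CorCM.HComp.OmegaConj

section Assembly

variable (F E : Type) [Field F] [NumberField F] [Field E] [NumberField E] [Algebra F E]
variable (c : E ≃ₐ[F] E) (hc : c * c = 1) (N : ℕ) {n : ℕ} (e : Fin N × Fin 1 ≃ Fin n)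
variable (JV : Matrix (Fin N) (Fin N) E) {TV : Matrix (Fin N) (Fin N) F}
variable [Algebra.IsQuadraticExtension F E] {δ : E} (hcδ : c δ = -δ) (hδ : δ ≠ 0) {d : F}
  (hd : δ * δ = algebraMap F E d) (hV : TV.IsSymm) (hVd : IsUnit TV.det) (hJV : JV = TV.map (algebraMap F E))

/-! ## §1 Transport along an equality of splitting families -/

/-- **`omegaAtLine` depends on the family `s` only**: an equality of families `s = s′` (any two compatibility proofs) gives the
IDENTITY `omegaAtLine hs a χ ≃ₗ[ℂ] omegaAtLine hs′ a χ` (by `subst`; the compatibility proof enters the finite factor only as a proof).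
[cite: Liu2021, Def. 4.11 (l. 2092–2096)] [cite: GelbartRogawski1991, §3.1 Remark p. 457 L4–13] -/
def omegaAtLineCongr
    {s s' : ∀ a : Fˣ, adelicPair F E c N 1 JV (JW F E a) →* adelicMpCont F (Fin n) (adelicGram F e TV (TW F a))} (h : s = s')
    (hs : ∀ a : Fˣ, (splittingDatum F E c N 1 e JV (JW F E a) hcδ hδ hd hV (isSymm_TW F a) hVd (isUnit_det_TW F a) hJV
      (JW_eq F E a)).IsCompatible (s a))
    (hs' : ∀ a : Fˣ, (splittingDatum F E c N 1 e JV (JW F E a) hcδ hδ hd hV (isSymm_TW F a) hVd (isUnit_det_TW F a) hJV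
      (JW_eq F E a)).IsCompatible (s' a)) (a : Fˣ) (χ : Chi F E c) :
    omegaAtLine F E c N e JV hcδ hδ hd hV hVd hJV hs a χ ≃ₗ[ℂ] omegaAtLine F E c N e JV hcδ hδ hd hV hVd hJV hs' a χ := by
  subst h
  exact LinearEquiv.refl ℂ _

/-- `omegaAtLineCongr` is the identity on classes. [cite: Liu2021, Def. 4.11 (l. 2092–2096)] -/
theorem omegaAtLineCongr_mk
    {s s' : ∀ a : Fˣ, adelicPair F E c N 1 JV (JW F E a) →* adelicMpCont F (Fin n) (adelicGram F e TV (TW F a))} (h : s = s')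
    (hs : ∀ a : Fˣ, (splittingDatum F E c N 1 e JV (JW F E a) hcδ hδ hd hV (isSymm_TW F a) hVd (isUnit_det_TW F a) hJV
      (JW_eq F E a)).IsCompatible (s a))
    (hs' : ∀ a : Fˣ, (splittingDatum F E c N 1 e JV (JW F E a) hcδ hδ hd hV (isSymm_TW F a) hVd (isUnit_det_TW F a) hJV
      (JW_eq F E a)).IsCompatible (s' a)) (a : Fˣ) (χ : Chi F E c) (f : FinSB F (Fin N × Fin 1)) :
    omegaAtLineCongr F E c N e JV hcδ hδ hd hV hVd hJV h hs hs' a χ (TwistedCoinv.mk _ _ f) = TwistedCoinv.mk _ _ f := by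
  subst h
  rfl

/-- **transport of the `U(J_V)`-action**: `omegaAtLineCongr` intertwines `rhoVAtLine hs` with `rhoVAtLine hs′`.
[cite: Liu2021, Def. 4.11 (l. 2092–2096)] -/
theorem omegaAtLineCongr_rhoVAtLine
    {s s' : ∀ a : Fˣ, adelicPair F E c N 1 JV (JW F E a) →* adelicMpCont F (Fin n) (adelicGram F e TV (TW F a))} (h : s = s')
    (hs : ∀ a : Fˣ, (splittingDatum F E c N 1 e JV (JW F E a) hcδ hδ hd hV (isSymm_TW F a) hVd (isUnit_det_TW F a) hJV
      (JW_eq F E a)).IsCompatible (s a))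
    (hs' : ∀ a : Fˣ, (splittingDatum F E c N 1 e JV (JW F E a) hcδ hδ hd hV (isSymm_TW F a) hVd (isUnit_det_TW F a) hJV
      (JW_eq F E a)).IsCompatible (s' a)) (a : Fˣ) (χ : Chi F E c) (k : finAdelic F E c N JV)
    (x : omegaAtLine F E c N e JV hcδ hδ hd hV hVd hJV hs a χ) :
    omegaAtLineCongr F E c N e JV hcδ hδ hd hV hVd hJV h hs hs' a χ (rhoVAtLine F E c N e JV hcδ hδ hd hV hVd hJV hs a χ k x) =
      rhoVAtLine F E c N e JV hcδ hδ hd hV hVd hJV hs' a χ k (omegaAtLineCongr F E c N e JV hcδ hδ hd hV hVd hJV h hs hs' a χ x) := by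
  subst h
  rfl

/-! ## §2 `𝔾`-equivariance of `Ω′` through two identifications `ι`, `ι′` and a map `φ` over `k ↦ k̄` -/

variable {s : ∀ a : Fˣ, adelicPair F E c N 1 JV (JW F E a) →* adelicMpCont F (Fin n) (adelicGram F e TV (TW F a))}
  (hs : ∀ a : Fˣ, (splittingDatum F E c N 1 e JV (JW F E a) hcδ hδ hd hV (isSymm_TW F a) hVd (isUnit_det_TW F a) hJV
    (JW_eq F E a)).IsCompatible (s a))

/-- **`Ω′ (ω(s′; a; χ)(g) x) = ω(s_{−a}; −a; χ⁻¹)(φ g) (Ω′ x)`** whenever `ι′ (φ g) = \overline{ι g}` — Part III's equivariance read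
through the consumer's identifications `ι : G →* U(J_V)(𝔸_f)`, `ι′ : G′ →* U(J_V)(𝔸_f)` (Liu's `𝔾(𝔸_F^∞)` of the space and of its
conjugate) and the comparison map `φ : G → G′`. [cite: Liu2021, Def. 4.11 (l. 2092–2096), App. C (l. 4624), Rem. 4.4] -/
theorem omegaConjEquiv_rhoAtLine {G G' : Type*} [Group G] [Group G'] [TopologicalSpace G] [TopologicalSpace G']
    (ι : G →* finAdelic F E c N JV) (ι' : G' →* finAdelic F E c N JV) (φ : G → G')
    (hφ : ∀ g : G, ι' (φ g) = finConjV F E c N JV hJV (ι g)) (a : Fˣ) (χ : Chi F E c) (g : G)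
    (x : omegaAtLine F E c N e JV hcδ hδ hd hV hVd hJV (isCompatible_conjFamily F E c N e JV hcδ hδ hd hV hVd hJV s hc hs) a χ) :
    omegaConjEquiv F E c hc N e JV hcδ hδ hd hV hVd hJV hs a χ
        (rhoAtLine F E c N e JV hcδ hδ hd hV hVd hJV (isCompatible_conjFamily F E c N e JV hcδ hδ hd hV hVd hJV s hc hs) ι a χ g x) =
      rhoAtLine F E c N e JV hcδ hδ hd hV hVd hJV hs ι' (-a) (chiInv F E c χ) (φ g)
        (omegaConjEquiv F E c hc N e JV hcδ hδ hd hV hVd hJV hs a χ x) := by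
  rw [rhoAtLine_apply, rhoAtLine_apply, hφ]
  exact omegaConjEquiv_rhoVAtLine F E c hc N e JV hcδ hδ hd hV hVd hJV hs a χ (ι g) x

end Assembly

end Summit.HodgeConjecture.CorCM.HComp.OmegaConj

end
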